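import Summits.CriticalPhenomena.PercolationContinuityZ3.Theorems.PercNearOneGluingNoHeavyLowerTailSahiChainTriangle
import Mathlib.Algebra.BigOperators.Ring.Finset
import Mathlib.Tactic.Linarith
import Mathlib.Tactic.Ring
import HarnessLib

/-!
# `NoHeavyLowerTail` (crux stmt-CriticalPhenomena-4575), P2: chain–cube–cube triangles, part 1/2 — product weights on a cube and THE ANTIPODAL-FIBRE IDENTITY

Support file (seat `prim-masterthm-p2`, gen 6; `--supports stmt-CriticalPhenomena-4575`).  No `sorry`, no named facts, standard axioms.
Memo SAHI-ROUTE.md §4.19.  Part 2 (`…SahiChainCubeTriangle`) proves Sahi's `C_3` for every triangle `f(c,a), g(c,b), h(a,b)` of increasing events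
with `c` in a finite CHAIN (any law) and `a, b` in finite CUBES (product laws).

This part (one definition, `cubeW`):
* `cubeW p a = ∏_{i∈a} p_i ∏_{i∉a} (1 − p_i)` — the product weight of a point of the cube `2^A` (`Finset A`); `cubeW_nonneg`, `sum_cubeW` (`= 1`),
  **`cubeW_mul_cubeW`** (log-modularity `w(a)w(a') = w(a ∩ a')w(a ∪ a')`);
* **`sum_pairs_eq_sum_fibres`** — THE ANTIPODAL-FIBRE IDENTITY: `Σ_{a,a'} w(a)w(a')ψ(a,a') = Σ_M Σ_{m⊆M} w(m)w(M) Σ_{η ⊆ M∖m} ψ(m ∪ η, M ∖ η)`: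
  a pair of independent clones of a product-measure point, conditioned on `(a ∩ a', a ∪ a') = (m, M)`, is a UNIFORM ANTIPODAL pair of the sub-cube
  `2^{M∖m}` (`sum_fibre`: the fibre is `{(m ∪ η, M ∖ η)}`).  This is the bridge from law-level clone integrals (`SahiChainTriangle.E6`) to the
  comb-level antipodal functionals of the triangle class (P5's `TRI`, prim-lf-1's `triWOne`);
* `sum_powerset_eq_sum_subtype`, `map_compl_subtype`, `sdiff_map_eq_union_map_compl` — the sub-cube `(M∖m).powerset` as the cube `Finset ↥(M∖m)`
  with its complementation (plumbing for the thin-edge theorem, which lives on `Finset β × Finset γ`).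
-/

noncomputable section

open scoped Classical

namespace Summit.CriticalPhenomena.PercolationContinuityZ3.Theorems

namespace SahiChainCubeTriangle

open Finset
open Literature.Combinatorics.Sahi2008

/-! ### §1  Product weights on a cube -/

section Cube

variable {A : Type} [Fintype A] [DecidableEq A]

/-- The product weight of the point `a` of the cube `2^A`: `∏_{i ∈ a} p_i · ∏_{i ∉ a} (1 − p_i)`. [folklore] -/
def cubeW (p : A → ℝ) (a : Finset A) : ℝ := ∏ i, if i ∈ a then p i else 1 - p i

/-- Product weights are nonnegative for parameters in `[0,1]`. [folklore] -/
theorem cubeW_nonneg {p : A → ℝ} (hp : ∀ i, 0 ≤ p i ∧ p i ≤ 1) (a : Finset A) : 0 ≤ cubeW p a := by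
  unfold cubeW
  refine prod_nonneg fun i _ => ?_
  split_ifs
  · exact (hp i).1
  · linarith [(hp i).2]

/-- Product weights sum to one. [folklore] -/
theorem sum_cubeW (p : A → ℝ) : ∑ a, cubeW p a = 1 := by
  have h := Finset.prod_add (fun i => p i) (fun i => 1 - p i) (univ : Finset A)
  simp only [add_sub_cancel, prod_const_one] at h
  rw [h, ← Finset.powerset_univ, eq_comm]
  · refine sum_congr rfl fun a _ => ?_
    unfold cubeW
    rw [← prod_filter_mul_prod_filter_not univ (fun i => i ∈ a)]
    congr 1
    · rw [show univ.filter (fun i => i ∈ a) = a by ext i; simp]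
      exact prod_congr rfl fun i hi => by rw [if_pos hi]
    · rw [show univ.filter (fun i => ¬ i ∈ a) = univ \ a by ext i; simp]
      exact prod_congr rfl fun i hi => by rw [if_neg (mem_sdiff.1 hi).2]

/-- **Log-modularity of a product weight**: `w(a)·w(a') = w(a ∩ a')·w(a ∪ a')`. [folklore] -/
theorem cubeW_mul_cubeW (p : A → ℝ) (a a' : Finset A) : cubeW p a * cubeW p a' = cubeW p (a ∩ a') * cubeW p (a ∪ a') := by
  unfold cubeW
  rw [← prod_mul_distrib, ← prod_mul_distrib]
  refine prod_congr rfl fun i _ => ?_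
  by_cases h1 : i ∈ a <;> by_cases h2 : i ∈ a' <;> simp [h1, h2, mem_inter, mem_union, mul_comm]

/-! ### §2  The antipodal-fibre identity for clone pairs on a cube -/

/-- The fibre of `(a,a') ↦ (a ∩ a', a ∪ a')` over `(m, M)`, `m ⊆ M`, is `{(m ∪ η, M \ η) : η ⊆ M \ m}`. [this work] -/
theorem sum_fibre (m M : Finset A) (hm : m ⊆ M) (F : Finset A → Finset A → ℝ) :
    ∑ η ∈ (M \ m).powerset, F (m ∪ η) (M \ η) =
      ∑ q ∈ (univ : Finset (Finset A × Finset A)).filter (fun q => q.1 ∩ q.2 = m ∧ q.1 ∪ q.2 = M), F q.1 q.2 := by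
  refine sum_nbij' (fun η => (m ∪ η, M \ η)) (fun q => q.1 \ m) ?_ ?_ ?_ ?_ ?_
  · intro η hη
    rw [mem_powerset] at hη
    rw [mem_filter]
    refine ⟨mem_univ _, ?_, ?_⟩
    · ext i
      simp only [mem_inter, mem_union, mem_sdiff]
      constructor
      · rintro ⟨h1 | h1, h2, h3⟩
        · exact h1
        · exact absurd h1 h3
      · intro hi
        exact ⟨Or.inl hi, hm hi, fun h => (mem_sdiff.1 (hη h)).2 hi⟩
    · ext i
      simp only [mem_union, mem_sdiff]
      constructor
      · rintro ((h1 | h1) | ⟨h2, _⟩)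
        · exact hm h1
        · exact (mem_sdiff.1 (hη h1)).1
        · exact h2
      · intro hi
        by_cases h : i ∈ η
        · exact Or.inl (Or.inr h)
        · exact Or.inr ⟨hi, h⟩
  · intro q hq
    rw [mem_filter] at hq
    rw [mem_powerset]
    intro i hi
    rw [mem_sdiff] at hi ⊢
    exact ⟨by rw [← hq.2.2]; exact mem_union.2 (Or.inl hi.1), hi.2⟩
  · intro η hη
    rw [mem_powerset] at hη
    ext i
    simp only [mem_sdiff, mem_union]
    constructor
    · rintro ⟨h1 | h1, h2⟩
      · exact absurd h1 h2
      · exact h1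
    · intro hi
      exact ⟨Or.inr hi, (mem_sdiff.1 (hη hi)).2⟩
  · intro q hq
    rw [mem_filter] at hq
    obtain ⟨-, h1, h2⟩ := hq
    have e1 : ∀ i, i ∈ q.1 ∩ q.2 ↔ i ∈ m := fun i => by rw [h1]
    have e2 : ∀ i, i ∈ q.1 ∪ q.2 ↔ i ∈ M := fun i => by rw [h2]
    simp only [mem_inter, mem_union] at e1 e2
    ext i
    · simp only [mem_union, mem_sdiff]
      constructor
      · rintro (hi | ⟨hi, -⟩)
        · exact ((e1 i).2 hi).1
        · exact hi
      · intro hi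
        by_cases h : i ∈ m
        · exact Or.inl h
        · exact Or.inr ⟨hi, h⟩
    · simp only [mem_sdiff, not_and, not_not]
      constructor
      · rintro ⟨hi, h⟩
        rcases (e2 i).2 hi with h' | h'
        · exact ((e1 i).2 (h h')).2
        · exact h'
      · intro hi
        exact ⟨(e2 i).1 (Or.inr hi), fun h => (e1 i).1 ⟨h, hi⟩⟩
  · intro η _
    rfl

/-- **THE ANTIPODAL-FIBRE IDENTITY.**  For a product weight `w` on the cube `2^A` and any `ψ`,
`Σ_{a,a'} w(a) w(a') ψ(a,a') = Σ_M Σ_{m ⊆ M} w(m) w(M) Σ_{η ⊆ M∖m} ψ(m ∪ η, M ∖ η)` — the law of a pair of independent clones, conditioned on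
`(a ∩ a', a ∪ a')`, is UNIFORM over the antipodal pairs of the sub-cube `2^{M∖m}`. [this work] -/
theorem sum_pairs_eq_sum_fibres (p : A → ℝ) (ψ : Finset A → Finset A → ℝ) :
    (∑ a, ∑ a', cubeW p a * cubeW p a' * ψ a a') =
      ∑ M, ∑ m ∈ M.powerset, cubeW p m * cubeW p M * ∑ η ∈ (M \ m).powerset, ψ (m ∪ η) (M \ η) := by
  -- group the pairs by the key `(a ∩ a', a ∪ a')`
  set key : Finset A × Finset A → Finset A × Finset A := fun q => (q.1 ∩ q.2, q.1 ∪ q.2) with hkey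
  set S : Finset (Finset A × Finset A) := univ.filter (fun r => r.1 ⊆ r.2) with hS
  have hmaps : ∀ q ∈ (univ : Finset (Finset A × Finset A)), key q ∈ S := by
    intro q _; rw [hS, mem_filter]; exact ⟨mem_univ _, inter_subset_union⟩
  have h1 : (∑ a, ∑ a', cubeW p a * cubeW p a' * ψ a a') =
      ∑ q : Finset A × Finset A, cubeW p q.1 * cubeW p q.2 * ψ q.1 q.2 := by
    rw [← Fintype.sum_prod_type']
  rw [h1, ← sum_fiberwise_of_maps_to hmaps]
  -- the sum over `S` is the sum over `M` and `m ⊆ M`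
  have h2 : (∑ r ∈ S, ∑ q ∈ univ.filter (fun q => key q = r), cubeW p q.1 * cubeW p q.2 * ψ q.1 q.2) =
      ∑ M, ∑ m ∈ M.powerset, ∑ q ∈ univ.filter (fun q => key q = (m, M)), cubeW p q.1 * cubeW p q.2 * ψ q.1 q.2 := by
    rw [hS, sum_filter, Fintype.sum_prod_type, sum_comm]
    refine sum_congr rfl fun M _ => ?_
    rw [← sum_filter]
    congr 1
    ext m
    simp only [mem_filter, mem_univ, true_and, mem_powerset]
  rw [h2]
  refine sum_congr rfl fun M _ => sum_congr rfl fun m hm => ?_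
  rw [mem_powerset] at hm
  have hfilt : univ.filter (fun q : Finset A × Finset A => key q = (m, M)) =
      univ.filter (fun q : Finset A × Finset A => q.1 ∩ q.2 = m ∧ q.1 ∪ q.2 = M) := by
    ext q; simp only [mem_filter, mem_univ, true_and, hkey, Prod.mk.injEq]
  have hf := sum_fibre m M hm (fun x y => cubeW p m * cubeW p M * ψ x y)
  rw [mul_sum, hf, hfilt]
  refine sum_congr rfl fun q hq => ?_
  rw [mem_filter] at hq
  rw [cubeW_mul_cubeW p q.1 q.2, hq.2.1, hq.2.2]


/-! ### §2b  Sub-cubes as cubes: sums over `D.powerset` versus `Finset ↥D` -/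

omit [Fintype A] in
/-- Reindexing a sum over the sub-cube `D.powerset` by the cube `Finset ↥D`. [folklore] -/
theorem sum_powerset_eq_sum_subtype (D : Finset A) (G : Finset A → ℝ) :
    ∑ η ∈ D.powerset, G η = ∑ η : Finset {i // i ∈ D}, G (η.map (Function.Embedding.subtype _)) := by
  refine sum_nbij' (fun η => η.subtype (· ∈ D)) (fun η' => η'.map (Function.Embedding.subtype _)) ?_ ?_ ?_ ?_ ?_
  · intro η _; exact mem_univ _
  · intro η' _
    rw [mem_powerset]
    intro i hi
    rw [mem_map] at hi
    obtain ⟨x, -, rfl⟩ := hi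
    exact x.2
  · intro η hη
    rw [mem_powerset] at hη
    exact subtype_map_of_mem fun x hx => hη hx
  · intro η' _
    ext x
    rw [mem_subtype]
    constructor
    · intro h
      obtain ⟨y, hy, hyx⟩ := mem_map.1 h
      have : y = x := Subtype.ext hyx
      exact this ▸ hy
    · intro h
      exact mem_map.2 ⟨x, h, rfl⟩
  · intro η hη
    rw [mem_powerset] at hη
    rw [subtype_map_of_mem fun x hx => hη hx]

omit [Fintype A] in
/-- The complement inside the cube `Finset ↥D` is the relative complement in `D`. [folklore] -/
theorem map_compl_subtype (D : Finset A) (η' : Finset {i // i ∈ D}) :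
    (η'ᶜ).map (Function.Embedding.subtype _) = D \ η'.map (Function.Embedding.subtype _) := by
  ext i
  simp only [mem_map, mem_sdiff, mem_compl, Function.Embedding.coe_subtype]
  constructor
  · rintro ⟨x, hx, rfl⟩
    refine ⟨x.2, ?_⟩
    rintro ⟨y, hy, hyx⟩
    have : y = x := Subtype.ext hyx
    exact hx (this ▸ hy)
  · rintro ⟨hiD, hnot⟩
    refine ⟨⟨i, hiD⟩, ?_, rfl⟩
    intro hmem
    exact hnot ⟨⟨i, hiD⟩, hmem, rfl⟩

omit [Fintype A] in
/-- The antipodal partner inside the fibre: `M \ η = m ∪ ((M \ m) \ η)` for `m ⊆ M`, `η ⊆ M \ m`. [folklore] -/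
theorem sdiff_eq_union_sdiff {m M η : Finset A} (hm : m ⊆ M) (hη : η ⊆ M \ m) : M \ η = m ∪ ((M \ m) \ η) := by
  ext i
  simp only [mem_union, mem_sdiff]
  constructor
  · rintro ⟨h1, h2⟩
    by_cases h : i ∈ m
    · exact Or.inl h
    · exact Or.inr ⟨⟨h1, h⟩, h2⟩
  · rintro (h | ⟨⟨h1, _⟩, h3⟩)
    · exact ⟨hm h, fun hη' => (mem_sdiff.1 (hη hη')).2 h⟩
    · exact ⟨h1, h3⟩

omit [Fintype A] in
/-- On the cube `Finset ↥(M \ m)`: the partner `M \ ↑η'` is `m ∪ ↑(η'ᶜ)`. [this work] -/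
theorem sdiff_map_eq_union_map_compl {m M : Finset A} (hm : m ⊆ M) (η' : Finset {i // i ∈ M \ m}) :
    M \ η'.map (Function.Embedding.subtype _) = m ∪ (η'ᶜ).map (Function.Embedding.subtype _) := by
  rw [map_compl_subtype]
  refine sdiff_eq_union_sdiff hm ?_
  intro i hi
  rw [mem_map] at hi
  obtain ⟨x, -, rfl⟩ := hi
  exact x.2

end Cube

end SahiChainCubeTriangle

end Summit.CriticalPhenomena.PercolationContinuityZ3.Theorems
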